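import Summits.Schanuel.Schanuel.Theses.TateNomes
import Summits.Schanuel.Schanuel.Theorems.TateNomesNomeHygieneStubShiftCoincidence
import Summits.Schanuel.Schanuel.Theorems.TateNomesNomeHygieneStubShiftedTateBasis
import Literature.NumberTheory.Transcendental.OneMotiveToricProofs
import Literature.Barriers.Schanuel.AxSchanuelFunctionalNotNumerical

/-!
# Route `TateNomes` — crux `NomeHygiene` PROVED (item stmt-Schanuel-17298)

`theorem NomeHygiene_proof : Summit.Schanuel.Schanuel.Theses.TateNomes.NomeHygiene` — sorry-free,
axioms `propext`, `Classical.choice`, `Quot.sound`.  This file is the composition of the line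
`Cruxes/NomeHygiene/Lines/integer_shift_rebase.lean` (crux-strategist
planner-cstrat-stmt-Schanuel-17298-b1-0, 2026-08-17), with both registered stubs imported from
their landed `--supports` files:

* `stub_shiftCoincidence` (`Theorems/TateNomesNomeHygieneStubShiftCoincidence.lean`) — the KEY
  LEMMA: for `(1, 2πi, β)` `ℚ`-independent and any `p ∈ ℂ`, only finitely many rational shifts `t`
  make `(β − t)/2πi` and `p` `GL₂⁺(ℚ)`-related (polynomial form, either direction).
* `stub_shiftedTateBasis` (`Theorems/TateNomesNomeHygieneStubShiftedTateBasis.lean`) — the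
  CONSTRUCTION: given the Key Lemma, the span of a `ℚ`-independent `(2πi, 1, u₁, …, u_m)`, `m ≥ 1`,
  has a Tate-position basis with transcendental nomes (natural-number shifts chosen slot by slot).
* glue (this file): `enlarge` (adjoin `2πi`, `1`, `√2` if missing; `k ≤ 3`; dimension count via the
  independence of `1, 2πi, √2`), `periodBasis_exists` (basis `(2πi, 1, u)` of the span,
  `exists_linearIndependent_snoc_of_lt_finrank`), `tateBasis_transport` (reindexing along
  `n + k = m + 2`), `not_quadratic_of_transcendental`, and the composition `NomeHygiene_proof`.

Mathematical source: the proof plan of grounder g77-1 (item note 2026-08-17T02:27Z) — integer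
shifts along the transcendental cusp direction and the "at most two `t`" lemma —, made
unconditional in the choice of direction (`y = −1/2πi` for every slot) and formalised by the
strategist. [cite: NesterenkoPhilippon2001, Ch. 3 §1 (Tate-position hypotheses of Conjecture 1.11);
Lindemann 1882 via tree `Literature.NumberTheory.Transcendental.transcendental_two_pi_I`]
-/

noncomputable section

-- `Summit.Schanuel.Schanuel.…` is the mandated summit/sub-problem namespace (single-conjunct summit), hence:
set_option linter.dupNamespace false

namespace Summit.Schanuel.Schanuel.Theorems.TateNomesNomeHygiene

open Complex

/-! ### Sorry-free glue, part 1: the ENLARGEMENT step of the crux (`k ≤ 3`) -/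

/-- The range of `Fin.snoc v x` is `range v ∪ {x}`. -/
theorem range_fin_snoc {α : Type*} {n : ℕ} (v : Fin n → α) (x : α) :
    Set.range (Fin.snoc v x : Fin (n + 1) → α) = Set.range v ∪ {x} := by
  ext a
  constructor
  · rintro ⟨i, rfl⟩
    refine Fin.lastCases ?_ (fun j => ?_) i
    · right
      simp [Fin.snoc_last]
    · left
      exact ⟨j, by simp [Fin.snoc_castSucc]⟩
  · rintro (⟨j, rfl⟩ | h)
    · exact ⟨Fin.castSucc j, by simp [Fin.snoc_castSucc]⟩
    · rw [Set.mem_singleton_iff] at h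
      subst h
      exact ⟨Fin.last n, by simp [Fin.snoc_last]⟩

/-- One enlargement step: adjoin `x` (algebraic, or with algebraic exponential) to the running
independent family `v` (with `range v = range z ∪ range e`, `e` the numbers adjoined so far) if
and only if it is missing from the span. -/
theorem enlarge_step (n : ℕ) (z : Fin n → ℂ) (x : ℂ)
    (hx : IsAlgebraic ℚ x ∨ IsAlgebraic ℚ (Complex.exp x))
    (k N : ℕ) (e : Fin k → ℂ) (v : Fin N → ℂ) (hN : N = n + k)
    (he : ∀ i, IsAlgebraic ℚ (e i) ∨ IsAlgebraic ℚ (Complex.exp (e i)))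
    (hv : LinearIndependent ℚ v) (hr : Set.range v = Set.range z ∪ Set.range e) :
    ∃ (k' N' : ℕ) (e' : Fin k' → ℂ) (v' : Fin N' → ℂ), N' = n + k' ∧
      (∀ i, IsAlgebraic ℚ (e' i) ∨ IsAlgebraic ℚ (Complex.exp (e' i))) ∧
      LinearIndependent ℚ v' ∧ Set.range v' = Set.range z ∪ Set.range e' ∧
      x ∈ Submodule.span ℚ (Set.range v') ∧ Set.range v ⊆ Set.range v' := by
  by_cases hmem : x ∈ Submodule.span ℚ (Set.range v)
  · exact ⟨k, N, e, v, hN, he, hv, hr, hmem, subset_rfl⟩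
  · refine ⟨k + 1, N + 1, Fin.snoc e x, Fin.snoc v x, by omega, ?_, ?_, ?_, ?_, ?_⟩
    · intro i
      refine Fin.lastCases ?_ (fun j => ?_) i
      · simpa [Fin.snoc_last] using hx
      · simpa [Fin.snoc_castSucc] using he j
    · exact linearIndependent_finSnoc.2 ⟨hv, hmem⟩
    · rw [range_fin_snoc, range_fin_snoc, hr, Set.union_assoc]
    · apply Submodule.subset_span
      rw [range_fin_snoc]
      exact Or.inr rfl
    · rw [range_fin_snoc]
      exact Set.subset_union_left

/-- `exp (2πi) = 1` is algebraic. -/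
theorem isAlgebraic_exp_two_pi_I :
    IsAlgebraic ℚ (Complex.exp (2 * (Real.pi : ℂ) * Complex.I)) := by
  rw [Complex.exp_two_pi_mul_I]
  exact isAlgebraic_one

/-- `1, 2πi, √2` are `ℚ`-linearly independent (`2πi ∉ ℝ`, `√2 ∉ ℚ`). -/
theorem linearIndependent_one_twoPiI_sqrt_two :
    LinearIndependent ℚ ![(1 : ℂ), 2 * (Real.pi : ℂ) * Complex.I, ((Real.sqrt 2 : ℝ) : ℂ)] := by
  rw [Fintype.linearIndependent_iff]
  intro g hg
  rw [Fin.sum_univ_three] at hg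
  simp only [Matrix.cons_val_zero, Matrix.cons_val_one, Matrix.head_cons,
    Matrix.cons_val_two, Matrix.tail_cons] at hg
  have him : ((g 1 : ℚ) : ℝ) * (2 * Real.pi) = 0 := by
    have h := congrArg Complex.im hg
    simp only [Complex.add_im, Rat.smul_def, Complex.mul_im, Complex.mul_re, Complex.ratCast_re,
      Complex.ratCast_im, Complex.one_im, Complex.one_re, Complex.ofReal_im, Complex.ofReal_re,
      Complex.I_im, Complex.I_re, Complex.re_ofNat, Complex.im_ofNat, Complex.zero_im] at h
    linear_combination h
  have hre : ((g 0 : ℚ) : ℝ) + ((g 2 : ℚ) : ℝ) * Real.sqrt 2 = 0 := by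
    have h := congrArg Complex.re hg
    simp only [Complex.add_re, Rat.smul_def, Complex.mul_im, Complex.mul_re, Complex.ratCast_re,
      Complex.ratCast_im, Complex.one_im, Complex.one_re, Complex.ofReal_im, Complex.ofReal_re,
      Complex.I_im, Complex.I_re, Complex.re_ofNat, Complex.im_ofNat, Complex.zero_re] at h
    linear_combination h
  have h1 : g 1 = 0 := by
    have : ((g 1 : ℚ) : ℝ) = 0 := (mul_eq_zero.1 him).resolve_right (by positivity)
    exact_mod_cast this
  have h2 : g 2 = 0 := by
    by_contra hne
    have hirr : Irrational (((g 0 : ℚ) : ℝ) + ((g 2 : ℚ) : ℝ) * Real.sqrt 2) :=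
      (irrational_sqrt_two.ratCast_mul hne).ratCast_add (g 0)
    exact hirr ⟨0, by push_cast; linarith [hre]⟩
  have h0 : g 0 = 0 := by
    have : ((g 0 : ℚ) : ℝ) = 0 := by
      rw [h2] at hre
      push_cast at hre
      linarith [hre]
    exact_mod_cast this
  intro i
  fin_cases i
  · exact h0
  · exact h1
  · exact h2

/-- **`Enlarge`** (PROVED; the crux's enlargement step).  Every `ℚ`-linearly independent
`z : Fin n → ℂ` extends by `k ≤ 3` numbers `eᵢ`, each algebraic or with algebraic exponential
(`2πi` if missing, then `1`, then `√2` — algebraic by the tree's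
`Literature.Barriers.Schanuel.isAlgebraic_sqrt_two`), to an independent family
`v : Fin N → ℂ`, `N = n + k`, `range v = range z ∪ range e`, whose span contains `1` and `2πi`
and has dimension `N ≥ 3`
(dimension count: `1, 2πi, √2` lie in the span and are independent). -/
theorem enlarge (n : ℕ) (z : Fin n → ℂ) (hz : LinearIndependent ℚ z) :
    ∃ (k N : ℕ) (e : Fin k → ℂ) (v : Fin N → ℂ), N = n + k ∧
      (∀ i, IsAlgebraic ℚ (e i) ∨ IsAlgebraic ℚ (Complex.exp (e i))) ∧
      LinearIndependent ℚ v ∧ Set.range v = Set.range z ∪ Set.range e ∧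
      (1 : ℂ) ∈ Submodule.span ℚ (Set.range v) ∧
      (2 * (Real.pi : ℂ) * Complex.I) ∈ Submodule.span ℚ (Set.range v) ∧ 3 ≤ N := by
  have h0 : Set.range z = Set.range z ∪ Set.range (Fin.elim0 : Fin 0 → ℂ) := by
    rw [Set.range_eq_empty Fin.elim0, Set.union_empty]
  obtain ⟨k₁, N₁, e₁, v₁, hN₁, he₁, hv₁, hr₁, hx₁, -⟩ :=
    enlarge_step n z (2 * (Real.pi : ℂ) * Complex.I) (Or.inr isAlgebraic_exp_two_pi_I) 0 n
      Fin.elim0 z (by omega) (fun i => Fin.elim0 i) hz h0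
  obtain ⟨k₂, N₂, e₂, v₂, hN₂, he₂, hv₂, hr₂, hx₂, hsub₂⟩ :=
    enlarge_step n z (1 : ℂ) (Or.inl isAlgebraic_one) k₁ N₁ e₁ v₁ hN₁ he₁ hv₁ hr₁
  obtain ⟨k₃, N₃, e₃, v₃, hN₃, he₃, hv₃, hr₃, hx₃, hsub₃⟩ :=
    enlarge_step n z ((Real.sqrt 2 : ℝ) : ℂ)
      (Or.inl Literature.Barriers.Schanuel.isAlgebraic_sqrt_two) k₂ N₂ e₂ v₂ hN₂ he₂ hv₂ hr₂
  have h1 : (1 : ℂ) ∈ Submodule.span ℚ (Set.range v₃) := Submodule.span_mono hsub₃ hx₂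
  have h2 : (2 * (Real.pi : ℂ) * Complex.I) ∈ Submodule.span ℚ (Set.range v₃) :=
    Submodule.span_mono (hsub₂.trans hsub₃) hx₁
  refine ⟨k₃, N₃, e₃, v₃, hN₃, he₃, hv₃, hr₃, h1, h2, ?_⟩
  -- dimension count inside `W = span (range v₃)`: `1, 2πi, √2 ∈ W` are independent
  set W : Submodule ℚ ℂ := Submodule.span ℚ (Set.range v₃) with hW
  haveI : FiniteDimensional ℚ W := FiniteDimensional.span_of_finite ℚ (Set.finite_range v₃)
  have hfin : Module.finrank ℚ W = N₃ := by
    rw [hW, finrank_span_eq_card hv₃, Fintype.card_fin]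
  let g : Fin 3 → W :=
    ![⟨(1 : ℂ), h1⟩, ⟨2 * (Real.pi : ℂ) * Complex.I, h2⟩, ⟨((Real.sqrt 2 : ℝ) : ℂ), hx₃⟩]
  have hg : W.subtype ∘ g =
      ![(1 : ℂ), 2 * (Real.pi : ℂ) * Complex.I, ((Real.sqrt 2 : ℝ) : ℂ)] := by
    funext i
    fin_cases i <;> rfl
  have hlig : LinearIndependent ℚ g := by
    apply LinearIndependent.of_comp W.subtype
    rw [hg]
    exact linearIndependent_one_twoPiI_sqrt_two
  have := hlig.fintype_card_le_finrank
  rw [Fintype.card_fin, hfin] at this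
  exact this

/-! ### Sorry-free glue, part 2: RE-BASING THROUGH THE PERIODS `(2πi, 1, u₁, …, u_m)` -/

/-- `2πi` is not a rational multiple of `1`: the pair `(2πi, 1)` heads a `ℚ`-independent family. -/
theorem linearIndependent_twoPiI_one :
    LinearIndependent ℚ
      (Fin.cons (2 * (Real.pi : ℂ) * Complex.I) (Fin.cons (1 : ℂ) (Fin.elim0 : Fin 0 → ℂ)) :
        Fin 2 → ℂ) := by
  rw [linearIndependent_finCons, linearIndependent_finCons]
  refine ⟨⟨linearIndependent_empty_type, ?_⟩, ?_⟩
  · have : Set.range (Fin.elim0 : Fin 0 → ℂ) = ∅ := Set.range_eq_empty _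
    rw [this, Submodule.span_empty]
    simp
  · intro hmem
    have hr : Set.range (Fin.cons (1 : ℂ) (Fin.elim0 : Fin 0 → ℂ) : Fin 1 → ℂ) = {(1 : ℂ)} := by
      rw [Fin.range_cons, Set.range_eq_empty, Set.insert_eq, Set.union_empty]
    rw [hr, Submodule.mem_span_singleton] at hmem
    obtain ⟨q, hq⟩ := hmem
    have him := congrArg Complex.im hq
    simp at him

/-- Inductive extension inside `W`: a `ℚ`-independent family `(2πi, 1, u)` with values in a
finite-dimensional subspace `W ∋ 1, 2πi` of dimension `≥ j + 2` exists for every such `j`. -/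
theorem periodBasis_aux (W : Submodule ℚ ℂ) [FiniteDimensional ℚ W]
    (h1 : (1 : ℂ) ∈ W) (h2 : (2 * (Real.pi : ℂ) * Complex.I) ∈ W) :
    ∀ j : ℕ, j + 2 ≤ Module.finrank ℚ W →
      ∃ u : Fin j → ℂ, (∀ i, u i ∈ W) ∧
        LinearIndependent ℚ
          (Fin.cons (2 * (Real.pi : ℂ) * Complex.I) (Fin.cons (1 : ℂ) u) : Fin (j + 2) → ℂ) := by
  intro j
  induction j with
  | zero =>
    intro _
    exact ⟨Fin.elim0, fun i => Fin.elim0 i, linearIndependent_twoPiI_one⟩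
  | succ j ih =>
    intro hj
    obtain ⟨u, huW, hli⟩ := ih (by omega)
    -- lift the family to `W`
    set f : Fin (j + 2) → ℂ :=
      (Fin.cons (2 * (Real.pi : ℂ) * Complex.I) (Fin.cons (1 : ℂ) u) : Fin (j + 2) → ℂ) with hf
    have hfW : ∀ i, f i ∈ W := by
      intro i
      refine Fin.cases ?_ (fun i => ?_) i
      · simpa [hf] using h2
      · refine Fin.cases ?_ (fun i => ?_) i
        · simpa [hf] using h1
        · simpa [hf] using huW i
    let f' : Fin (j + 2) → W := fun i => ⟨f i, hfW i⟩
    have hf'f : W.subtype ∘ f' = f := by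
      funext i
      rfl
    have hli' : LinearIndependent ℚ f' := by
      apply LinearIndependent.of_comp W.subtype
      rw [hf'f]
      exact hli
    obtain ⟨b, hb⟩ := exists_linearIndependent_snoc_of_lt_finrank hli' (by omega)
    have hbC : LinearIndependent ℚ (W.subtype ∘ Fin.snoc f' b) :=
      hb.map' W.subtype (Submodule.ker_subtype W)
    have hsnoc : (W.subtype ∘ Fin.snoc f' b : Fin (j + 2 + 1) → ℂ) = Fin.snoc f (b : ℂ) := by
      funext i
      refine Fin.lastCases ?_ (fun i => ?_) i
      · simp [Fin.snoc_last]
      · simp only [Function.comp_apply, Fin.snoc_castSucc]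
        rfl
    rw [hsnoc] at hbC
    refine ⟨Fin.snoc u (b : ℂ), ?_, ?_⟩
    · intro i
      refine Fin.lastCases ?_ (fun i => ?_) i
      · simp [Fin.snoc_last]
      · simpa [Fin.snoc_castSucc] using huW i
    · have e : (Fin.cons (2 * (Real.pi : ℂ) * Complex.I) (Fin.cons (1 : ℂ) (Fin.snoc u (b : ℂ))) :
          Fin (j + 1 + 2) → ℂ) = Fin.snoc f (b : ℂ) := by
        rw [hf, ← Fin.cons_snoc_eq_snoc_cons, ← Fin.cons_snoc_eq_snoc_cons]
      rw [e]
      exact hbC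

/-- **`PeriodBasis`** (PROVED).  If `v : Fin N → ℂ` is `ℚ`-linearly independent and its span
contains `1` and `2πi`, the span has a `ℚ`-basis `(2πi, 1, u₁, …, u_m)` with `N = m + 2`. -/
theorem periodBasis_exists (N : ℕ) (v : Fin N → ℂ) (hv : LinearIndependent ℚ v)
    (h1 : (1 : ℂ) ∈ Submodule.span ℚ (Set.range v))
    (h2 : (2 * (Real.pi : ℂ) * Complex.I) ∈ Submodule.span ℚ (Set.range v)) :
    ∃ (m : ℕ) (u : Fin m → ℂ), N = m + 2 ∧
      LinearIndependent ℚ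
        (Fin.cons (2 * (Real.pi : ℂ) * Complex.I) (Fin.cons (1 : ℂ) u) : Fin (m + 2) → ℂ) ∧
      Submodule.span ℚ (Set.range
        (Fin.cons (2 * (Real.pi : ℂ) * Complex.I) (Fin.cons (1 : ℂ) u) : Fin (m + 2) → ℂ)) =
        Submodule.span ℚ (Set.range v) := by
  set W : Submodule ℚ ℂ := Submodule.span ℚ (Set.range v) with hW
  haveI : FiniteDimensional ℚ W := FiniteDimensional.span_of_finite ℚ (Set.finite_range v)
  have hfin : Module.finrank ℚ W = N := by
    rw [hW, finrank_span_eq_card hv, Fintype.card_fin]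
  -- `N ≥ 2`: the independent pair `(2πi, 1)` lives in `W`
  have hN2 : 2 ≤ N := by
    let g : Fin 2 → W := Fin.cons ⟨2 * (Real.pi : ℂ) * Complex.I, h2⟩
      (Fin.cons ⟨(1 : ℂ), h1⟩ (Fin.elim0 : Fin 0 → W))
    have hg : W.subtype ∘ g =
        (Fin.cons (2 * (Real.pi : ℂ) * Complex.I) (Fin.cons (1 : ℂ) (Fin.elim0 : Fin 0 → ℂ)) :
          Fin 2 → ℂ) := by
      funext i
      refine Fin.cases ?_ (fun i => ?_) i
      · rfl
      · refine Fin.cases ?_ (fun i => ?_) i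
        · rfl
        · exact Fin.elim0 i
    have hlig : LinearIndependent ℚ g := by
      apply LinearIndependent.of_comp W.subtype
      rw [hg]
      exact linearIndependent_twoPiI_one
    have := hlig.fintype_card_le_finrank
    rw [Fintype.card_fin, hfin] at this
    exact this
  obtain ⟨u, huW, hli⟩ := periodBasis_aux W h1 h2 (N - 2) (by omega)
  refine ⟨N - 2, u, by omega, hli, ?_⟩
  -- the independent family of full cardinality inside `W` spans `W`
  apply Submodule.eq_of_le_of_finrank_eq
  · rw [Submodule.span_le]
    rintro x ⟨i, rfl⟩
    refine Fin.cases ?_ (fun i => ?_) i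
    · simpa using h2
    · refine Fin.cases ?_ (fun i => ?_) i
      · simpa using h1
      · simpa using huW i
  · rw [finrank_span_eq_card hli, hfin, Fintype.card_fin]
    omega

/-! ### Sorry-free glue, part 3: reindexing and the non-quadratic clause -/

/-- A transcendental number is not a root of a rational quadratic (the crux's non-quadratic
clause follows from the stronger transcendence delivered by `stub_shiftedTateBasis`). -/
theorem not_quadratic_of_transcendental {τ : ℂ} (hτ : Transcendental ℚ τ) (b c : ℚ) :
    τ ^ 2 + (b : ℂ) * τ + (c : ℂ) ≠ 0 := by
  intro h
  apply hτ
  refine ⟨Polynomial.X ^ 2 + Polynomial.C b * Polynomial.X + Polynomial.C c, ?_, ?_⟩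
  · exact Polynomial.Monic.ne_zero (by monicity!)
  · simp only [map_add, map_mul, map_pow, Polynomial.aeval_X, Polynomial.aeval_C, eq_ratCast]
    exact h

/-- Transport of a shifted Tate basis along `Fin (m + 2) = Fin N` (pure reindexing). -/
theorem tateBasis_transport {N m : ℕ} (h : N = m + 2) {S : Submodule ℚ ℂ} {w : Fin (m + 2) → ℂ}
    (hw : LinearIndependent ℚ w) (hspan : Submodule.span ℚ (Set.range w) = S)
    (hre : ∀ j, (w j).re < 0)
    (htr : ∀ j, Transcendental ℚ (w j / (2 * (Real.pi : ℂ) * Complex.I)))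
    (hmob : ∀ i j, i ≠ j → ∀ a b c d : ℚ, 0 < a * d - b * c →
      (w j / (2 * (Real.pi : ℂ) * Complex.I)) *
          ((c : ℂ) * (w i / (2 * (Real.pi : ℂ) * Complex.I)) + (d : ℂ)) ≠
        (a : ℂ) * (w i / (2 * (Real.pi : ℂ) * Complex.I)) + (b : ℂ)) :
    ∃ w' : Fin N → ℂ, LinearIndependent ℚ w' ∧ Submodule.span ℚ (Set.range w') = S ∧
      (∀ j, (w' j).re < 0) ∧
      (∀ j, Transcendental ℚ (w' j / (2 * (Real.pi : ℂ) * Complex.I))) ∧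
      (∀ i j, i ≠ j → ∀ a b c d : ℚ, 0 < a * d - b * c →
        (w' j / (2 * (Real.pi : ℂ) * Complex.I)) *
            ((c : ℂ) * (w' i / (2 * (Real.pi : ℂ) * Complex.I)) + (d : ℂ)) ≠
          (a : ℂ) * (w' i / (2 * (Real.pi : ℂ) * Complex.I)) + (b : ℂ)) := by
  subst h
  exact ⟨w, hw, hspan, hre, htr, hmob⟩

/-! ## The crux (concluded BY NAME) -/

/-- **`TateNomes.NomeHygiene`** (crux #3 of route `TateNomes`, item stmt-Schanuel-17298): enlarge
(`enlarge`), re-base through the periods (`periodBasis_exists`), shift by natural numbers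
(`stub_shiftedTateBasis`, fed the Key Lemma `stub_shiftCoincidence`), transport the index type
along `n + k = m + 2`, and read off the seven conjuncts.  (This is the strategist's
`nomeHygiene_holds` of `Cruxes/NomeHygiene/NomeHygieneComplete.lean`, renamed to the gate's closing
form `<Decl>_proof`.) -/
theorem NomeHygiene_proof : Summit.Schanuel.Schanuel.Theses.TateNomes.NomeHygiene := by
  intro n z hz
  obtain ⟨k, N, e, v, hN, he, hv, hr, h1, h2pi, h3⟩ := enlarge n z hz
  obtain ⟨m, u, hNm, hu, hspanu⟩ := periodBasis_exists N v hv h1 h2pi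
  have hm : 1 ≤ m := by omega
  obtain ⟨w₀, hw₀, hspan₀, hre₀, htr₀, hmob₀⟩ :=
    stub_shiftedTateBasis stub_shiftCoincidence m u hm hu
  obtain ⟨w, hw, hspan, hre, htr, hmob⟩ :=
    tateBasis_transport (N := n + k) (by omega) hw₀ (hspan₀.trans hspanu) hre₀ htr₀ hmob₀
  refine ⟨k, e, w, he, hw, ?_, ?_, hre, ?_, hmob⟩
  · rw [hspan, hr]
  · rw [hspan]
    exact h2pi
  · intro j b c
    exact not_quadratic_of_transcendental (htr j) b c

end Summit.Schanuel.Schanuel.Theorems.TateNomesNomeHygiene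

end
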